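import Literature.NumberTheory.EllipticCurves.CyclotomicZpExtensionLayerProofs
import HarnessLib

/-!
# The first layer of the cyclotomic `ℤ₃`-extension of `ℚ` contains `ℚ(ζ₉)⁺ = ℚ[t]/(t³ − 3t + 1)`,
# together with the automorphism `t ↦ t² − 2` (cell `bsd-eis`, seat `bsd-eis-k5-c3` gen 5; THEOREMS ONLY)

HONEST FRAMING (FULL-BSD rank-≤1 programme D-0033, cell `bsd-eis`, `run/shared/lean/pub/bsd-eis/`; rung K5, crux 3
`MazurMCOnCellB`, row A10-split). Nothing booked, no label moves. This file closes the field-theoretic half of the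
«KERNEL GAP at the certificate level» recorded in `Iwasawa/RankGrowthLayer.lean` (iw-1, RANK-GROWTH-L1.md §5:
«Identification `ℚ(ζ_9)⁺ ≅ κ.layer 1` (p = 3) … the certificate's READING»): for EVERY cyclotomic
`κ : ZpExtension ℚ 3` the first layer `κ.layer 1 ⊆ ℚ̄` (the fixed field of `κ⁻¹(3ℤ₃)`) contains
`θ = ζ₉ + ζ₉⁻¹`, a root of `t³ − 3t + 1`, and carries a ring automorphism `σ` with `σ θ = θ² − 2`
(the restriction of any `τ ∈ Γ_ℚ` with `χ₃(τ) ≡ 2 (mod 9)`). With `[κ.layer 1 : ℚ] = 3`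
(`ZpExtension.finrank_layer_holds`) this is all that the layer-`1` rank certificates of
`Iwasawa/LayerOneRankCertificate.lean` need about the layer.

Proof (Washington §13.1, written out): unit twists do not move layers (`layer_unitTwist`,
`IsCyclotomic.exists_eq_unitTwist_holds`), so it suffices to treat `κ_cyc = ℓ ∘ χ₃`
(`CyclotomicZp.zpExtension`). If `3 ∣ ℓ(χ₃ σ)` then `γ_cyc^{2ℓ(u)} = u²` (`cycPow_torsionOrder_mul_ell`,
`t = #μ(ℤ₃) = 2`) and `‖γ_cyc^y − 1‖ = ‖y‖·‖3‖` (`PadicOneUnits.norm_oneAddPow_sub_one`, Serre II.3.2)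
give `u² ≡ 1 (mod 9)`, so `χ₃(σ) ≡ ±1 (mod 9)` and `σ ζ₉ = ζ₉^{±1}` (Mathlib's `cyclotomicCharacter.spec`
through `GaloisRep.cyclotomicCharacter_spec`), whence `σ` fixes `ζ₉ + ζ₉⁸`. The cubic relation is
`(ζ + ζ⁸)³ − 3(ζ + ζ⁸) + 1 = (ζ⁶ + ζ³ + 1) + (ζ⁹ − 1)(…)` with `ζ³` a primitive cube root of unity.

References: L. C. Washington, *Introduction to Cyclotomic Fields*, 2nd ed. (1997), §13.1 [Washington1997];
J.-P. Serre, *A Course in Arithmetic*, Ch. II §3.2 Prop. 8 [Serre1973]; R. Greenberg, LNM 1716 (1999),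
§1 p. 63 (the layers `ℚ_n` of the cyclotomic `ℤ_p`-extension) [GreenbergLNM1716].
-/

noncomputable section

open Field IntermediateField
open Literature.NumberTheory.GaloisRepresentations
open Literature.NumberTheory.EllipticCurves Literature.NumberTheory.EllipticCurves.PadicOneUnits
  Literature.NumberTheory.EllipticCurves.CyclotomicZp

namespace Summit.BirchSwinnertonDyer.Rank1Residual.Iwasawa.CyclotomicLayerOne


/-! ## §1 `κ_cyc⁻¹(3ℤ₃)` acts on `μ₉` through `±1` -/

/-- For `σ ∈ κ_cyc⁻¹(3ℤ₃)` (the subgroup cutting out the first layer of the normalised cyclotomic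
`ℤ₃`-extension): `χ₃(σ)² ≡ 1 (mod 9)`. [cite: Washington1997, §13.1] [cite: Serre1973, Ch. II §3.2 Prop. 8] -/
theorem toZModPow_two_sq_eq_one {σ : absoluteGaloisGroup ℚ} (hσ : σ ∈ (zpExtension 3).layerSubgroup 1) :
    (PadicInt.toZModPow 2 ((GaloisRep.cyclotomicCharacter ℚ 3 σ : ℤ_[3]ˣ) : ℤ_[3])) ^ 2 = 1 := by
  set u : ℤ_[3]ˣ := GaloisRep.cyclotomicCharacter ℚ 3 σ with hu
  -- `3 ∣ ℓ(u)`
  rw [ZpExtension.mem_layerSubgroup, zpExtension_apply, toAdd_ofAdd, pow_one] at hσ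
  obtain ⟨y, hy⟩ := hσ
  -- `γ_cyc^{2 ℓ(u)} = u ^ 2`
  have ht : torsionOrder 3 = 2 := by
    rw [torsionOrder, cyclotomicExponent, if_neg (by decide), pow_one, Nat.totient_prime (by norm_num)]
  have he : cyclotomicExponent 3 - 1 = 0 := by rw [cyclotomicExponent, if_neg (by decide)]
  have h1 : cycPow 3 (torsionOrder 3 * ell 3 u) = (u : ℤ_[3]) ^ 2 := by
    rw [cycPow_torsionOrder_mul_ell, ht]
  -- `‖γ_cyc^x − 1‖ = ‖x‖ · ‖3‖`
  have h2 : ‖cycPow 3 (torsionOrder 3 * ell 3 u) - 1‖ =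
      ‖(torsionOrder 3 : ℤ_[3]) * ell 3 u‖ * ‖(3 : ℤ_[3]) ^ (0 + 1)‖ := by
    have := norm_oneAddPow_sub_one (p := 3) 0 (by norm_num) ((torsionOrder 3 : ℤ_[3]) * ell 3 u)
    rw [cycPow, he]
    exact this
  rw [h1, ht, hy, zero_add, pow_one] at h2
  -- hence `‖u² − 1‖ ≤ ‖9‖`
  have h3 : ‖(u : ℤ_[3]) ^ 2 - 1‖ ≤ ‖(3 : ℤ_[3]) ^ 2‖ := by
    rw [h2, norm_pow, pow_two]
    refine mul_le_mul_of_nonneg_right ?_ (norm_nonneg _)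
    calc ‖((2 : ℕ) : ℤ_[3]) * (3 * y)‖ = ‖((2 : ℕ) : ℤ_[3])‖ * (‖(3 : ℤ_[3])‖ * ‖y‖) := by
          rw [norm_mul, norm_mul]
      _ ≤ 1 * (‖(3 : ℤ_[3])‖ * 1) := by
          gcongr
          · exact PadicInt.norm_le_one _
          · exact PadicInt.norm_le_one _
      _ = ‖(3 : ℤ_[3])‖ := by ring
  -- i.e. `u² − 1 ∈ 9ℤ₃ = ker (toZModPow 2)`
  have h4 : (u : ℤ_[3]) ^ 2 - 1 ∈ Ideal.span {((3 : ℕ) : ℤ_[3]) ^ 2} := by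
    rw [← PadicInt.norm_le_pow_iff_mem_span_pow]
    have hp : ‖(3 : ℤ_[3])‖ = ((3 : ℕ) : ℝ)⁻¹ := PadicInt.norm_p
    refine h3.trans (le_of_eq ?_)
    rw [norm_pow, hp, zpow_neg, zpow_natCast, inv_pow]
  rw [← PadicInt.ker_toZModPow, RingHom.mem_ker, map_sub, map_pow, map_one, sub_eq_zero] at h4
  exact h4

/-- Squares roots of `1` in `ℤ/9`: `x² = 1 ⇒ x = 1 ∨ x = 8`. [folklore] -/
theorem zmod_nine_sq_eq_one {x : ZMod 9} (hx : x ^ 2 = 1) : x = 1 ∨ x = 8 := by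
  revert x hx; decide

/-- For `σ ∈ κ_cyc⁻¹(3ℤ₃)` and `ζ⁹ = 1` in `ℚ̄`: `σ ζ = ζ` or `σ ζ = ζ⁸`. [cite: Washington1997, §13.1] -/
theorem smul_eq_or_eq_pow_eight {σ : absoluteGaloisGroup ℚ} (hσ : σ ∈ (zpExtension 3).layerSubgroup 1)
    (ζ : AlgebraicClosure ℚ) (hζ : ζ ^ 9 = 1) : σ • ζ = ζ ∨ σ • ζ = ζ ^ 8 := by
  haveI : NeZero ((3 : ℕ) : ℚ) := ⟨by norm_num⟩
  have hspec := GaloisRep.cyclotomicCharacter_spec ℚ 3 (k := 2) σ ζ (by simpa using hζ)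
  rcases zmod_nine_sq_eq_one (toZModPow_two_sq_eq_one hσ) with h | h
  · left
    rw [hspec]
    have : (PadicInt.toZModPow 2 ((GaloisRep.cyclotomicCharacter ℚ 3 σ : ℤ_[3]ˣ) : ℤ_[3])).val = 1 := by
      rw [h]; decide
    rw [this, pow_one]
  · right
    rw [hspec]
    have : (PadicInt.toZModPow 2 ((GaloisRep.cyclotomicCharacter ℚ 3 σ : ℤ_[3]ˣ) : ℤ_[3])).val = 8 := by
      rw [h]; decide
    rw [this]

/-- For `σ ∈ κ_cyc⁻¹(3ℤ₃)`, `σ` fixes `ζ + ζ⁸ = ζ₉ + ζ₉⁻¹` (`ζ⁹ = 1`). [cite: Washington1997, §13.1] -/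
theorem smul_theta_eq {σ : absoluteGaloisGroup ℚ} (hσ : σ ∈ (zpExtension 3).layerSubgroup 1)
    (ζ : AlgebraicClosure ℚ) (hζ : ζ ^ 9 = 1) : σ • (ζ + ζ ^ 8) = ζ + ζ ^ 8 := by
  rw [smul_add, smul_pow']
  rcases smul_eq_or_eq_pow_eight hσ ζ hζ with h | h
  · rw [h]
  · rw [h, ← pow_mul, show 8 * 8 = 9 * 7 + 1 by norm_num, pow_add, pow_mul, hζ, one_pow, one_mul,
      pow_one, add_comm]

/-! ## §2 `θ = ζ₉ + ζ₉⁻¹` lies in the first layer of EVERY cyclotomic `κ`, and `θ³ − 3θ + 1 = 0` -/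

/-- `ζ + ζ⁸ ∈ κ.layer 1` for every cyclotomic `κ : ZpExtension ℚ 3` and every `ζ` with `ζ⁹ = 1`
(`κ = κ_cyc.unitTwist u`, `layer_unitTwist`, and §1). [cite: Washington1997, §13.1] -/
theorem zeta_add_pow_mem_layer_one {κ : ZpExtension ℚ 3} (hκ : κ.IsCyclotomic)
    (ζ : AlgebraicClosure ℚ) (hζ : ζ ^ 9 = 1) : ζ + ζ ^ 8 ∈ κ.layer 1 := by
  obtain ⟨u, rfl⟩ := ZpExtension.IsCyclotomic.exists_eq_unitTwist_holds (isCyclotomic_zpExtension 3) hκ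
  rw [ZpExtension.layer_unitTwist, ZpExtension.layer, IntermediateField.mem_fixedField_iff]
  intro g hg
  obtain ⟨σ, hσ, rfl⟩ := Subgroup.mem_map.mp hg
  exact smul_theta_eq hσ ζ hζ

/-- The cubic relation: for a PRIMITIVE `9`-th root of unity `ζ`, `θ = ζ + ζ⁸` satisfies
`θ³ − 3θ + 1 = 0` (`ζ³` is a primitive cube root of unity, `ζ⁶ + ζ³ + 1 = 0`). [folklore] -/
theorem theta_cubic {F : Type*} [Field F] {ζ : F} (hζ : IsPrimitiveRoot ζ 9) :
    (ζ + ζ ^ 8) ^ 3 - 3 * (ζ + ζ ^ 8) + 1 = 0 := by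
  have h9 : ζ ^ 9 = 1 := hζ.pow_eq_one
  have hω : IsPrimitiveRoot (ζ ^ 3) 3 := hζ.pow (by norm_num) (show 9 = 3 * 3 by norm_num)
  have h3 : ζ ^ 6 + ζ ^ 3 + 1 = 0 := by
    have := hω.geom_sum_eq_zero (by norm_num : 1 < 3)
    simp only [Finset.sum_range_succ, Finset.sum_range_zero, zero_add, ← pow_mul] at this
    linear_combination this
  linear_combination (3 * ζ + 3 * ζ ^ 8 + ζ ^ 15 + ζ ^ 6) * h9 + h3

/-- **The first layer of every cyclotomic `ℤ₃`-extension of `ℚ` contains a root of `t³ − 3t + 1`**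
(namely `ζ₉ + ζ₉⁻¹`; `κ.layer 1 = ℚ(ζ₉)⁺`). [cite: Washington1997, §13.1] [cite: GreenbergLNM1716, §1 (p. 63)] -/
theorem exists_cubicRoot_mem_layer_one {κ : ZpExtension ℚ 3} (hκ : κ.IsCyclotomic) :
    ∃ θ : AlgebraicClosure ℚ, θ ∈ κ.layer 1 ∧ θ ^ 3 - 3 * θ + 1 = 0 ∧
      ∃ ζ : AlgebraicClosure ℚ, IsPrimitiveRoot ζ 9 ∧ θ = ζ + ζ ^ 8 := by
  haveI : NeZero ((9 : ℕ) : AlgebraicClosure ℚ) := ⟨by norm_num⟩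
  obtain ⟨ζ, hζ⟩ := HasEnoughRootsOfUnity.exists_primitiveRoot (AlgebraicClosure ℚ) 9
  exact ⟨ζ + ζ ^ 8, zeta_add_pow_mem_layer_one hκ ζ hζ.pow_eq_one, theta_cubic hζ, ζ, hζ, rfl⟩

/-! ## §3 The automorphism `θ ↦ θ² − 2` of the first layer -/

/-- Some `τ ∈ Γ_ℚ` has `χ₃(τ) ≡ 2 (mod 9)`; it sends a `9`-th root of unity `ζ` to `ζ²`, hence
`θ = ζ + ζ⁸` to `θ² − 2 = ζ² + ζ⁷`. [cite: Washington1997, §13.1] -/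
theorem exists_smul_theta_eq_sq_sub_two (ζ : AlgebraicClosure ℚ) (hζ : ζ ^ 9 = 1) :
    ∃ τ : absoluteGaloisGroup ℚ, τ • (ζ + ζ ^ 8) = (ζ + ζ ^ 8) ^ 2 - 2 := by
  haveI : NeZero ((3 : ℕ) : ℚ) := ⟨by norm_num⟩
  obtain ⟨τ, hτ⟩ := GaloisRep.exists_cyclotomicCharacter_toZModPow_eq (p := 3) 2 2 (by norm_num)
  refine ⟨τ, ?_⟩
  have hspec := GaloisRep.cyclotomicCharacter_spec ℚ 3 (k := 2) τ ζ (by simpa using hζ)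
  have hval : (PadicInt.toZModPow 2 ((GaloisRep.cyclotomicCharacter ℚ 3 τ : ℤ_[3]ˣ) : ℤ_[3])).val = 2 := by
    rw [hτ]; decide
  rw [hval] at hspec
  rw [smul_add, smul_pow', hspec]
  linear_combination (-2 : AlgebraicClosure ℚ) * hζ

/-- **The first layer of every cyclotomic `ℤ₃`-extension of `ℚ` contains a root `θ` of `t³ − 3t + 1`
and carries a ring endomorphism `σ` with `σ θ = θ² − 2`** (the layer is normal over `ℚ`
(`ZpExtension.isGalois_layer_holds`), so any `τ ∈ Γ_ℚ` with `χ₃(τ) ≡ 2 (mod 9)` restricts to it,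
Mathlib `AlgHom.restrictNormal`). This is the field-theoretic input of the layer-`1` rank certificates
(`Iwasawa/LayerOneRankCertificate.lean`). [cite: Washington1997, §13.1] [cite: GreenbergLNM1716, §1 (p. 63)] -/
theorem exists_cubicRoot_and_endomorphism_layer_one {κ : ZpExtension ℚ 3} (hκ : κ.IsCyclotomic) :
    ∃ (θ : κ.layer 1) (σ : κ.layer 1 →+* κ.layer 1), θ ^ 3 - 3 * θ + 1 = 0 ∧ σ θ = θ ^ 2 - 2 := by
  obtain ⟨θ₀, hmem, hcub, ζ, hζ, rfl⟩ := exists_cubicRoot_mem_layer_one hκ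
  obtain ⟨τ, hτ⟩ := exists_smul_theta_eq_sq_sub_two ζ hζ.pow_eq_one
  haveI : IsGalois ℚ (κ.layer 1) := κ.isGalois_layer_holds 1
  -- `τ` as a `ℚ`-algebra automorphism of `ℚ̄`, restricted to the normal subextension `κ.layer 1`
  set τ' : AlgebraicClosure ℚ →ₐ[ℚ] AlgebraicClosure ℚ := (absoluteGaloisGroup.toAlgEquiv ℚ τ).toAlgHom
    with hτ'
  have hτ'' : ∀ x, τ' x = τ • x := fun x => rfl
  refine ⟨⟨ζ + ζ ^ 8, hmem⟩, (τ'.restrictNormal (κ.layer 1)).toRingHom, ?_, ?_⟩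
  · apply Subtype.ext
    push_cast
    exact hcub
  · have hc := AlgHom.restrictNormal_commutes τ' (κ.layer 1) ⟨ζ + ζ ^ 8, hmem⟩
    rw [IntermediateField.algebraMap_apply, IntermediateField.algebraMap_apply, hτ'', hτ] at hc
    rw [AlgHom.toRingHom_eq_coe, AlgHom.coe_toRingHom]
    apply (IntermediateField.val (κ.layer 1)).toRingHom.injective
    rw [AlgHom.toRingHom_eq_coe, AlgHom.coe_toRingHom, map_sub, map_pow, map_ofNat,
      IntermediateField.coe_val]
    exact hc

end Summit.BirchSwinnertonDyer.Rank1Residual.Iwasawa.CyclotomicLayerOne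

end
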